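import Summits.Ventures.LatticeQCDFlow.Scoring.BlockFactorProcess
import Summits.Ventures.LatticeQCDFlow.Scoring.FejerPairSums

/-!
# Second moments of the block sums of a block-factor process: `Var[Σ_{l<n} X_{a+l}] = v(n)`, `v(n)/n → σ² = γ(0) + 2Σ_{t≤m} γ(t)`, and the Bernstein-block `L¹` bounds

HONEST FRAMING: exact (Metropolis-corrected) sampling algorithms for lattice gauge theory;
figures of merit are autocorrelation/cost numbers at stated couplings and volumes; no
continuum-physics claim.

Venture `LatticeQCDFlow` (cell pub-lqcd), sub-topic `Scoring`; FANOUT row 16 (`su2-base`), GEN-7.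
NEW WORK of the cell over Mathlib, `Scoring/BlockFactorProcess` and GEN-6's Fejér lemma
(`Scoring/FejerPairSums.tendsto_sum_sum_int_sub_div`); nothing here is cited as a fact.  Printed
counterpart NAMED ONLY: Lehmann 1999 eqs. (2.8.5), (2.8.9), (2.8.12) (held, pp. 92–93).

Second file of the LAW-OF-THE-ERROR packet: the deterministic and second-moment inputs of the
Bernstein-block proof of the central limit theorem for `X_i = F(ξ_i, …, ξ_{i+m})`.

## Contents (`γ(t) = cov[X_0, X_t]`, `μ = E X_0`)

* `blockVar γ n = Σ_{l,l'<n} γ(|l' − l|)` (`v(n)`), `lrVar γ m = γ(0) + 2 Σ_{t=1}^{m} γ(t)` (`σ²`, the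
  LONG-RUN VARIANCE); `tsum_int_natAbs_eq_lrVar` (`Σ_{z∈ℤ} γ(|z|) = σ²` when `γ` vanishes beyond `m`);
  **`tendsto_blockVar_div`** (`v(n)/n → σ²`), `tendsto_blockVar_div_add` (`v(k)/(k+m) → σ²`).
* `covariance_blockFactor` (`cov[X_i, X_j] = γ(|j − i|)`), **`covariance_blockFactor_eq_zero`**
  (`γ(t) = 0` for `t > m`), **`variance_cblockSum`** (`Var[Σ_{l<n}(X_{a+l} − μ)] = v(n)` at every
  position), `integral_cblockSum_sq`, `blockVar_nonneg`, **`lrVar_nonneg`** (`σ² ≥ 0`).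
* `integral_abs_le_sqrt_integral_sq_of_memLp` (`E|Z| ≤ √(E Z²)`).
* The Bernstein blocks with period `p = k + m`, `k ≥ m`: **`integral_abs_sum_smallBlocks_le`** — the
  `n` small blocks (length `m`, offset `k`) are independent and centred, so `E|Σ_{j<n} V_j| ≤ √(n v(m))`;
  **`integral_abs_remainder_le`** — a block of `r < p` terms has `E|R| ≤ √(Σ_{r'<p} v(r'))` wherever
  it sits; **`cblockSum_decomposition`** — `Σ_{i<N} (X_i − μ) = Σ_{j<⌊N/p⌋} U_j + (Σ_{j<⌊N/p⌋} V_j + R)`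
  with big blocks `U_j` (length `k` at `jp`), small blocks `V_j` (length `m` at `jp + k`) and the
  remainder (the last `N mod p` terms).

NOT CLAIMED: `σ² > 0` (it can vanish, e.g. `X_i = ξ_{i+1} − ξ_i`); rates.
-/

noncomputable section

open MeasureTheory ProbabilityTheory Filter Finset
open scoped Topology

namespace Summit.Ventures.LatticeQCDFlow.Scoring

variable {Ω : Type*} [MeasurableSpace Ω] {P : Measure Ω}
variable {S : Type*} [MeasurableSpace S]

/-! ## Second moments of block sums and the long-run variance -/

section SecondMoments

/-- The variance of a block sum of `n` consecutive terms of a second-order stationary sequence with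
autocovariance `γ`: `v(n) = Σ_{l,l'<n} γ(|l' − l|)`. [ours] -/
def blockVar (γ : ℕ → ℝ) (n : ℕ) : ℝ :=
  ∑ l ∈ range n, ∑ l' ∈ range n, γ (((l' : ℤ) - l).natAbs)

/-- The LONG-RUN VARIANCE of an `m`-dependent second-order stationary sequence:
`σ² = γ(0) + 2 Σ_{k=1}^{m} γ(k)` (Lehmann 1999 eq. (2.8.9)). [ours] -/
def lrVar (γ : ℕ → ℝ) (m : ℕ) : ℝ :=
  γ 0 + 2 * ∑ k ∈ range m, γ (k + 1)

/-- An autocovariance vanishing beyond lag `m`, read on `ℤ` through `|·|`, is finitely supported,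
hence summable. -/
theorem summable_int_natAbs_of_eq_zero {γ : ℕ → ℝ} {m : ℕ} (hγ : ∀ k, m < k → γ k = 0) :
    Summable fun z : ℤ => γ z.natAbs := by
  refine summable_of_ne_finset_zero (s := Finset.Icc (-(m : ℤ)) m) fun z hz => ?_
  refine hγ _ ?_
  simp only [Finset.mem_Icc, not_and_or, not_le] at hz
  omega

/-- `Σ_{z ∈ ℤ} γ(|z|) = γ(0) + 2 Σ_{k=1}^{m} γ(k)` for an autocovariance vanishing beyond lag `m`. -/
theorem tsum_int_natAbs_eq_lrVar {γ : ℕ → ℝ} {m : ℕ} (hγ : ∀ k, m < k → γ k = 0) :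
    ∑' z : ℤ, γ z.natAbs = lrVar γ m := by
  rw [tsum_int_eq_zero_add_tsum_nat (summable_int_natAbs_of_eq_zero hγ), lrVar]
  congr 1
  have h2 : ∀ t : ℕ, γ ((t : ℤ) + 1).natAbs + γ (-((t : ℤ) + 1)).natAbs = 2 * γ (t + 1) := by
    intro t
    rw [Int.natAbs_neg, show ((t : ℤ) + 1).natAbs = t + 1 by omega]
    ring
  simp_rw [h2]
  rw [tsum_eq_sum (s := range m) fun t ht => ?_, mul_sum]
  rw [hγ (t + 1) (by simp only [mem_range, not_lt] at ht; omega), mul_zero]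

/-- **`v(n)/n → σ²`**: the variance of a block sum per term converges to the long-run variance
(Fejér/Tannery, `Scoring/FejerPairSums`). -/
theorem tendsto_blockVar_div {γ : ℕ → ℝ} {m : ℕ} (hγ : ∀ k, m < k → γ k = 0) :
    Tendsto (fun n : ℕ => blockVar γ n / n) atTop (𝓝 (lrVar γ m)) := by
  have h := tendsto_sum_sum_int_sub_div (summable_int_natAbs_of_eq_zero hγ)
  rw [tsum_int_natAbs_eq_lrVar hγ] at h
  refine h.congr fun n => ?_
  simp only [blockVar]

/-- Hence `v(k)/(k + m) → σ²` as the block length `k → ∞` with the gap `m` fixed. -/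
theorem tendsto_blockVar_div_add {γ : ℕ → ℝ} {m : ℕ} (hγ : ∀ k, m < k → γ k = 0) :
    Tendsto (fun k : ℕ => blockVar γ k / (k + m)) atTop (𝓝 (lrVar γ m)) := by
  have h1 : Tendsto (fun k : ℕ => (k : ℝ) / (k + m)) atTop (𝓝 1) := by
    have h := tendsto_natCast_div_add_atTop (m : ℝ)
    exact h
  have h := (tendsto_blockVar_div hγ).mul h1
  rw [mul_one] at h
  refine h.congr' ?_
  filter_upwards [eventually_gt_atTop 0] with k hk
  have hk' : (k : ℝ) ≠ 0 := Nat.cast_ne_zero.2 (Nat.pos_iff_ne_zero.1 hk)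
  field_simp

variable [IsProbabilityMeasure P] {ξ : ℕ → Ω → S} {m : ℕ} {F : (Fin (m + 1) → S) → ℝ}

/-- The covariance of any two terms of a block-factor process is the autocovariance at the lag:
`cov[X_i, X_j] = cov[X_0, X_{|j−i|}]`. -/
theorem covariance_blockFactor (hind : iIndepFun ξ P) (hid : ∀ i, IdentDistrib (ξ i) (ξ 0) P P)
    (hF : Measurable F) (h2 : MemLp (blockFactor F ξ 0) 2 P) (i j : ℕ) :
    cov[blockFactor F ξ i, blockFactor F ξ j; P]
      = cov[blockFactor F ξ 0, blockFactor F ξ (((j : ℤ) - i).natAbs); P] := by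
  rcases le_or_gt i j with h | h
  · obtain ⟨k, rfl⟩ := Nat.exists_eq_add_of_le h
    rw [covariance_blockFactor_add hind hid hF h2 i k]
    congr 2
    omega
  · obtain ⟨k, rfl⟩ := Nat.exists_eq_add_of_le h.le
    rw [covariance_comm, covariance_blockFactor_add hind hid hF h2 j k]
    congr 2
    omega

omit [IsProbabilityMeasure P] in
/-- **`m`-dependence of the autocovariance**: `cov[X_0, X_k] = 0` for `k > m`. -/
theorem covariance_blockFactor_eq_zero (hξ : ∀ i, Measurable (ξ i)) (hind : iIndepFun ξ P)
    (hid : ∀ i, IdentDistrib (ξ i) (ξ 0) P P) (hF : Measurable F)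
    (h2 : MemLp (blockFactor F ξ 0) 2 P) {k : ℕ} (hk : m < k) :
    cov[blockFactor F ξ 0, blockFactor F ξ k; P] = 0 :=
  (indepFun_blockFactor hξ hind hF (i := 0) (j := k) (by omega)).covariance_eq_zero
    (memLp_blockFactor hind hid hF h2 0) (memLp_blockFactor hind hid hF h2 k)

/-- **The variance of a block sum**: `Var[Σ_{l<n} (X_{a+l} − μ)] = v(n)` with
`γ(k) = cov[X_0, X_k]`, at every position `a`. -/
theorem variance_cblockSum (hind : iIndepFun ξ P) (hid : ∀ i, IdentDistrib (ξ i) (ξ 0) P P)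
    (hF : Measurable F) (h2 : MemLp (blockFactor F ξ 0) 2 P) (μ : ℝ) (a n : ℕ) :
    Var[cblockSum (blockFactor F ξ) μ a n; P]
      = blockVar (fun k => cov[blockFactor F ξ 0, blockFactor F ξ k; P]) n := by
  have hm := fun b => memLp_blockFactor hind hid hF h2 b
  have hi := fun b => (hm b).integrable one_le_two
  have hmc : ∀ l ∈ range n, MemLp (fun ω => blockFactor F ξ (a + l) ω - μ) 2 P :=
    fun l _ => (hm (a + l)).sub (memLp_const μ)
  rw [show cblockSum (blockFactor F ξ) μ a n
      = fun ω => ∑ l ∈ range n, (blockFactor F ξ (a + l) ω - μ) from rfl, blockVar,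
    variance_fun_sum' hmc]
  refine sum_congr rfl fun l _ => sum_congr rfl fun l' _ => ?_
  rw [covariance_sub_const_left (hi _), covariance_sub_const_right (hi _),
    covariance_blockFactor hind hid hF h2]
  congr 2
  push_cast
  ring_nf

/-- **The second moment of a centred block sum**: `E[(Σ_{l<n} (X_{a+l} − E X_0))²] = v(n)`. -/
theorem integral_cblockSum_sq (hind : iIndepFun ξ P) (hid : ∀ i, IdentDistrib (ξ i) (ξ 0) P P)
    (hF : Measurable F) (h2 : MemLp (blockFactor F ξ 0) 2 P) (a n : ℕ) :
    P[cblockSum (blockFactor F ξ) (P[blockFactor F ξ 0]) a n ^ 2]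
      = blockVar (fun k => cov[blockFactor F ξ 0, blockFactor F ξ k; P]) n := by
  have h := variance_eq_sub (memLp_cblockSum hind hid hF h2 (P[blockFactor F ξ 0]) a n)
  rw [integral_cblockSum hind hid hF h2, variance_cblockSum hind hid hF h2] at h
  linarith [h]

/-- The variance of a block sum is non-negative (it is a variance). -/
theorem blockVar_nonneg (hind : iIndepFun ξ P) (hid : ∀ i, IdentDistrib (ξ i) (ξ 0) P P)
    (hF : Measurable F) (h2 : MemLp (blockFactor F ξ 0) 2 P) (n : ℕ) :
    0 ≤ blockVar (fun k => cov[blockFactor F ξ 0, blockFactor F ξ k; P]) n := by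
  rw [← variance_cblockSum hind hid hF h2 0 0 n]
  exact variance_nonneg _ _

/-- **The long-run variance of a block-factor process is non-negative** (limit of `v(n)/n ≥ 0`). -/
theorem lrVar_nonneg (hξ : ∀ i, Measurable (ξ i)) (hind : iIndepFun ξ P)
    (hid : ∀ i, IdentDistrib (ξ i) (ξ 0) P P) (hF : Measurable F)
    (h2 : MemLp (blockFactor F ξ 0) 2 P) :
    0 ≤ lrVar (fun k => cov[blockFactor F ξ 0, blockFactor F ξ k; P]) m :=
  ge_of_tendsto' (tendsto_blockVar_div fun _ hk => covariance_blockFactor_eq_zero hξ hind hid hF h2 hk)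
    fun n => div_nonneg (blockVar_nonneg hind hid hF h2 n) (Nat.cast_nonneg n)

end SecondMoments

/-! ## `E|Z| ≤ √(E Z²)` -/

section SecondMomentBound

variable [IsProbabilityMeasure P]

/-- `E|Z| ≤ √(E Z²)` for `Z ∈ L²` of a probability space (the variance of `|Z|` is non-negative). -/
theorem integral_abs_le_sqrt_integral_sq_of_memLp {Z : Ω → ℝ} (hZ : MemLp Z 2 P) :
    ∫ ω, |Z ω| ∂P ≤ Real.sqrt (∫ ω, Z ω ^ 2 ∂P) := by
  have habs : MemLp (fun ω => |Z ω|) 2 P := hZ.abs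
  have hv := variance_nonneg (fun ω => |Z ω|) P
  rw [variance_eq_sub habs] at hv
  have h2 : P[(fun ω => |Z ω|) ^ 2] = ∫ ω, Z ω ^ 2 ∂P :=
    integral_congr_ae (ae_of_all _ fun ω => by simp [sq_abs])
  rw [h2] at hv
  refine Real.le_sqrt_of_sq_le ?_
  have h3 : P[fun ω => |Z ω|] = ∫ ω, |Z ω| ∂P := rfl
  rw [h3] at hv
  linarith

end SecondMomentBound

/-! ## Bernstein blocks: the small blocks and the remainder are negligible in `L¹` -/

section Blocks

variable [IsProbabilityMeasure P] {ξ : ℕ → Ω → S} {m : ℕ} {F : (Fin (m + 1) → S) → ℝ}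

/-- **The small blocks.**  With period `p = k + m` (`k ≥ m`), the `n` small blocks
`V_j = Σ_{l<m} (X_{jp+k+l} − μ)` are independent, centred, each of variance `v(m)`, so
`E|Σ_{j<n} V_j| ≤ √(n · v(m))`. -/
theorem integral_abs_sum_smallBlocks_le (hξ : ∀ i, Measurable (ξ i)) (hind : iIndepFun ξ P)
    (hid : ∀ i, IdentDistrib (ξ i) (ξ 0) P P) (hF : Measurable F)
    (h2 : MemLp (blockFactor F ξ 0) 2 P) {k : ℕ} (hk : m ≤ k) (n : ℕ) :
    ∫ ω, |∑ j ∈ range n, cblockSum (blockFactor F ξ) (P[blockFactor F ξ 0]) (j * (k + m) + k) m ω| ∂P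
      ≤ Real.sqrt (n * blockVar (fun t => cov[blockFactor F ξ 0, blockFactor F ξ t; P]) m) := by
  set μ : ℝ := P[blockFactor F ξ 0] with hμ
  set V : ℕ → Ω → ℝ := fun j => cblockSum (blockFactor F ξ) μ (j * (k + m) + k) m with hV
  have hV2 : ∀ j, MemLp (V j) 2 P := fun j => memLp_cblockSum hind hid hF h2 μ _ m
  have hVind : iIndepFun V P :=
    iIndepFun_cblockSum_periodic hξ hind hF μ (n := m) (p := k + m) (c := k) (by omega)
  have hV0 : ∀ j, P[V j] = 0 := fun j => integral_cblockSum hind hid hF h2 _ m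
  have hVvar : ∀ j, Var[V j; P] = blockVar (fun t => cov[blockFactor F ξ 0, blockFactor F ξ t; P]) m :=
    fun j => variance_cblockSum hind hid hF h2 μ _ m
  -- the sum `W = Σ_{j<n} V_j`
  have hW2 : MemLp (fun ω => ∑ j ∈ range n, V j ω) 2 P := memLp_finsetSum _ fun j _ => hV2 j
  have hWeq : (fun ω => ∑ j ∈ range n, V j ω) = ∑ j ∈ range n, V j := by
    funext ω; simp only [Finset.sum_apply]
  have hW0 : P[fun ω => ∑ j ∈ range n, V j ω] = 0 := by
    rw [integral_finsetSum _ fun j _ => (hV2 j).integrable one_le_two]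
    exact sum_eq_zero fun j _ => hV0 j
  have hWvar : Var[fun ω => ∑ j ∈ range n, V j ω; P]
      = n * blockVar (fun t => cov[blockFactor F ξ 0, blockFactor F ξ t; P]) m := by
    rw [hWeq, IndepFun.variance_sum (fun j _ => hV2 j) fun i _ j _ hij => hVind.indepFun hij]
    simp only [hVvar, sum_const, card_range, nsmul_eq_mul]
  have hWsq : ∫ ω, (∑ j ∈ range n, V j ω) ^ 2 ∂P
      = n * blockVar (fun t => cov[blockFactor F ξ 0, blockFactor F ξ t; P]) m := by
    have h := variance_eq_sub hW2
    rw [hWvar, hW0] at h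
    have h' : P[(fun ω => ∑ j ∈ range n, V j ω) ^ 2] = ∫ ω, (∑ j ∈ range n, V j ω) ^ 2 ∂P := rfl
    rw [← h']
    linarith
  calc ∫ ω, |∑ j ∈ range n, V j ω| ∂P
      ≤ Real.sqrt (∫ ω, (∑ j ∈ range n, V j ω) ^ 2 ∂P) :=
        integral_abs_le_sqrt_integral_sq_of_memLp hW2
    _ = _ := by rw [hWsq]

/-- **The remainder.**  A block of fewer than `p` terms has `E|R| ≤ √(Σ_{r<p} v(r))`, uniformly in
its position. -/
theorem integral_abs_remainder_le (hind : iIndepFun ξ P)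
    (hid : ∀ i, IdentDistrib (ξ i) (ξ 0) P P) (hF : Measurable F)
    (h2 : MemLp (blockFactor F ξ 0) 2 P) {p r : ℕ} (hr : r < p) (a : ℕ) :
    ∫ ω, |cblockSum (blockFactor F ξ) (P[blockFactor F ξ 0]) a r ω| ∂P
      ≤ Real.sqrt (∑ r' ∈ range p,
          blockVar (fun t => cov[blockFactor F ξ 0, blockFactor F ξ t; P]) r') := by
  refine (integral_abs_le_sqrt_integral_sq_of_memLp (memLp_cblockSum hind hid hF h2 _ a r)).trans
    (Real.sqrt_le_sqrt ?_)
  have h := integral_cblockSum_sq hind hid hF h2 a r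
  have h' : P[cblockSum (blockFactor F ξ) (P[blockFactor F ξ 0]) a r ^ 2]
      = ∫ ω, cblockSum (blockFactor F ξ) (P[blockFactor F ξ 0]) a r ω ^ 2 ∂P := rfl
  rw [← h', h]
  exact single_le_sum (f := fun r' => blockVar (fun t => cov[blockFactor F ξ 0, blockFactor F ξ t; P]) r')
    (fun r' _ => blockVar_nonneg hind hid hF h2 r') (mem_range.2 hr)

omit [MeasurableSpace Ω] [MeasurableSpace S] [IsProbabilityMeasure P] in
/-- **The Bernstein decomposition** of the centred sum of the first `N` terms with period
`p = k + m`: big blocks (length `k`) + small blocks (length `m`) + a remainder of `N mod p` terms. -/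
theorem cblockSum_decomposition (X : ℕ → Ω → ℝ) (μ : ℝ) (k N : ℕ) (ω : Ω) :
    cblockSum X μ 0 N ω
      = ∑ j ∈ range (N / (k + m)), cblockSum X μ (j * (k + m) + 0) k ω
        + (∑ j ∈ range (N / (k + m)), cblockSum X μ (j * (k + m) + k) m ω
          + cblockSum X μ (N / (k + m) * (k + m)) (N % (k + m)) ω) := by
  set p := k + m with hp
  set n := N / p with hn
  conv_lhs => rw [← Nat.div_add_mod' N p]
  rw [cblockSum_add, zero_add, cblockSum_mul, ← add_assoc, ← sum_add_distrib]
  congr 1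
  refine sum_congr rfl fun j _ => ?_
  rw [add_zero, hp, cblockSum_add]

end Blocks

end Summit.Ventures.LatticeQCDFlow.Scoring

end
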